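import Summits.QuantumFields.BalabanUV.T4Continuum.Support.NE7SliceLetterBalabanGauge
import Summits.QuantumFields.BalabanUV.T4Continuum.Support.NE3FrameFreeDecompositionW
import Summits.QuantumFields.BalabanUV.T4Continuum.Spine.NE3.PairLandauB8

/-!
# NE7QbarKernelDecomposition — BAŁABAN's STRAIGHT SLICE IS ROW NE3's FRAME-FREE SLICE PLUS THE `N(Q′(W))`-GAUGE ORBIT: every skew periodic `Y` with
# `QbarIter L (j+1) W Y = 0` is `X − D_W λ` with `X ∈ frameFreeBlockLandauW L N (j+1) W` (row NE3's `T_♮(W)`) and `λ ∈ avgKernelGauges L N (j+1) W` (`N(Q′(W))`)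
# — the kinematic decomposition behind the orbit comparison of the slice Poincaré letter (H1) (file 148 of the curved (APE), F219)

Cell `pub-balaban`, rung (B)+1 sub-cell t4, lineage `b2b-balaban-t4-ne7-p1` (CRUX PROVER NE7 #1 = OWNER of row NE7), generation 86; memo
`t4/b2b-balaban-t4-ne7-p1-g86/ORBIT-COMPARISON.md` §1.
WHY.  The END of record F218 `NE7ApeCurvedRepRoadBSlicePoincareEnd` rests on (H1) — row NE3's slice Poincaré SHAPE on OUR slice `T_A = ker Q̄_W ∩ {R D_W† = 0}` — while row NE3
proves it (`NE3ClassSlicePoincare.classSlicePoincare_of_lines`) on ITS slice `T_♮ = frameFreeBlockLandauW`.  Gen 86 compares the two through the `N(Q′(W))`-gauge orbits of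
`ker Q̄_W`; THIS file is the exact kinematic half: `ker Q̄_W = T_♮ + D_W N(Q′(W))`.  Mechanism, all BY NAME: row NE3's structure theorem `dirIter = QbarIter + gaugeDir_c ∘ framePotW`
read through lineage #2's exact test transport `NE7SliceLetterBalabanGauge.dirIter_testLift_eq_zero` (the corner lift of MINUS the accumulated frames makes a straight-tangent field
contour-tangent), then row NE3's (E_W) `NE3FrameFreeDecompositionW.exists_cornerGauge_mem_frameFreeBlockLandauW` (frame kill + projection onto `D_W Ξ₀₀(W)`), and the curved (‡)
`NE3CovariantBlockMean.framePotW_gaugeDir` to read off that the TOTAL gauge parameter has vanishing nested block mean: frame-freeness of the end point forces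
`bmeanIterW (corner lift + corner-trivial gauge) = 0`.
WHAT ([folklore]; 0 def, 0 sorry).  §1 the corner lift of the accumulated frames (skew, periodic, corner values); §2 **`exists_avgKernelGauge_mem_frameFreeBlockLandauW`**:
for skew `(N·L^{j+1})`-periodic `Y` with `QbarIter L (j+1) W Y = 0` there is `λ ∈ avgKernelGauges L N (j+1) W` with `Y + gaugeDir W λ ∈ frameFreeBlockLandauW L N (j+1) W`.
HONEST FRAMING (page 1): exact lattice kinematics at one background of the multi-level small-field class; nothing of Bałaban's asserted; (H1), (P_a), (KL-B), (APE) on curved data NOT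
proved here; NOT ONE-STEP, NOT NE7; spine 0∕9; finite T⁴ rung (B)+1 — NOT infinite volume, NOT mass gap, NOT `BetaPertH`, NOT Clay.  Continuum YM on T⁴ ⇐ BetaPertH ∧ nine spine
estimates (0/9 proved); BetaPertH ⇐ (D1) ∧ (D4) ∧ CAP+tail; G-an2-4 gates asym, D1 and NE2/3/4.
-/

set_option autoImplicit false

open scoped BigOperators Matrix.Norms.L2Operator
open Finset

namespace Summit.QuantumFields.BalabanUV.T4Continuum.NE7QbarKernelDecomposition

open Literature.MathematicalPhysics.QuantumFieldTheory.Balaban1983to89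
open B7Prop1Explicit B7Prop2Explicit
open T4AveragingDeficitWall (IsUnitaryCfg IsSkewDir SmallField)
open T4AveragingDeficitWallBoundary (IsPeriodicCfg periodBox)
open AveragingDeficitPeriodicCounting (IsPeriodicDir)
open AveragingDeficitMultiLevelPrep (TangentIter tower LevelSmall)
open BlockAveragePushDirGauge (gaugeDir isPeriodicDir_gaugeDir)
open NE3TangentCovariantTower (QbarIter framePotW dirIter tangentIter_iff_dirIter_eq_zero)
open NE3CovariantBlockMean (bmeanIterW framePotW_gaugeDir)
open NE3CurvedFrameKill (framePotW_add framePotW_skew_periodic)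
open NE3FrameFreeSliceW (frameFreeBlockLandauW bmeanIterW_add)
open NE3FrameFreeDecompositionW (exists_cornerGauge_mem_frameFreeBlockLandauW)
open NE3FramePotBoundW (tower_eq_pow_mul)
open NE3HilbertSchmidtTorus (gaugeDir_add_fun)
open NE3LandauOrbit (gaugeDir_skew)
open NE3.PairLandauB8 (avgKernelGauges mem_avgKernelGauges_iff)
open NE7FlatSliceStraightReduction (cornerLift cornerLift_corner cornerLift_add_period cornerLift_mem_skewAdjoint)
open NE7SliceLetterBalabanGauge (dirIter_testLift_eq_zero)

noncomputable section

variable {d : ℕ} {n : Type*} [Fintype n] [DecidableEq n] [Nonempty n]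

section Class

variable {L N : ℕ} [NeZero N] (hL : 1 ≤ L) (hLd : 2 ≤ L ^ d) (j : ℕ)
  {W : Site d → Fin d → (Matrix n n ℂ)ˣ} {x : ℝ} (hWu : IsUnitaryCfg W) (hWP : IsPeriodicCfg W ((tower L N (j + 1) : ℕ) : ℤ))
  (hx : 0 ≤ x) (hs : LevelSmall d L j x) (hWx : SmallField W x)

/-! ## §1 The corner lift of minus the accumulated frames -/

include hL hWu hWP hx hs hWx in
/-- The corner lift `ν := cornerLift (L^{j+1}) (−framePotW L (j+1) W Y)` of a skew `tower`-periodic `Y` is skew, `tower`-periodic, and its corner values are MINUS the frames.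
[folklore] -/
theorem testLift_skew_periodic_corner {Y : Site d → Fin d → Matrix n n ℂ} (hY : IsSkewDir Y) (hYP : IsPeriodicDir Y ((tower L N (j + 1) : ℕ) : ℤ)) :
    (∀ y, cornerLift (L ^ (j + 1)) (fun z => -framePotW L (j + 1) W Y z) y ∈ skewAdjoint (Matrix n n ℂ)) ∧
    (∀ (y : Site d) (i : Fin d), cornerLift (L ^ (j + 1)) (fun z => -framePotW L (j + 1) W Y z) (y + ((tower L N (j + 1) : ℕ) : ℤ) • e i)
        = cornerLift (L ^ (j + 1)) (fun z => -framePotW L (j + 1) W Y z) y) ∧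
    (∀ w : Site d, cornerLift (L ^ (j + 1)) (fun z => -framePotW L (j + 1) W Y z) (((L : ℤ) ^ (j + 1)) • w) = -framePotW L (j + 1) W Y w) := by
  obtain ⟨hθs, hθP⟩ := framePotW_skew_periodic hL j hWu hWP hx hs hWx hY hYP
  have hM1 : 1 ≤ L ^ (j + 1) := Nat.one_le_pow _ _ hL
  have hcast : ((L : ℤ) ^ (j + 1)) = ((L ^ (j + 1) : ℕ) : ℤ) := by push_cast; ring
  have htow : ((tower L N (j + 1) : ℕ) : ℤ) = ((L ^ (j + 1) : ℕ) : ℤ) * (N : ℤ) := by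
    rw [tower_eq_pow_mul]; push_cast; ring
  refine ⟨fun y => cornerLift_mem_skewAdjoint _ (fun z => (skewAdjoint (Matrix n n ℂ)).neg_mem (hθs z)) y, fun y i => ?_, fun w => ?_⟩
  · rw [htow]
    exact cornerLift_add_period hM1 (F := fun z => -framePotW L (j + 1) W Y z) (fun z τ => by simp only [hθP z τ]) y i
  · rw [hcast, cornerLift_corner hM1]

/-! ## §2 The decomposition `ker Q̄_W = T_♮(W) + D_W N(Q′(W))` -/

include hL hLd hWu hWP hx hs hWx in
/-- **BAŁABAN's STRAIGHT SLICE = ROW NE3's FRAME-FREE SLICE + THE `N(Q′(W))`-ORBIT.**  In the multi-level small-field class (unitary `W` of period `tower L N (j+1) = L^{j+1}·N`,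
`0 ≤ x`, `LevelSmall d L j x`, `SmallField W x`; `L ≥ 1`, `L^d ≥ 2`), every skew `tower`-periodic `Y` with `QbarIter L (j+1) W Y = 0` has a gauge parameter
`λ ∈ avgKernelGauges L N (j+1) W` (skew, periodic, `bmeanIterW L (j+1) W λ = 0`) with `Y + gaugeDir W λ ∈ frameFreeBlockLandauW L N (j+1) W`.
Construction: `λ = ν + μ`, `ν` the corner lift of minus the frames (`dirIter (Y + D_Wν) = 0`, lineage #2), `μ` row NE3's corner-trivial (E_W) gauge of `Y + D_Wν`; frame-freeness
of the end point and the curved (‡) give `bmeanIterW μ = framePotW (Y + D_Wν) = −bmeanIterW ν`. [folklore] -/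
theorem exists_avgKernelGauge_mem_frameFreeBlockLandauW {Y : Site d → Fin d → Matrix n n ℂ} (hY : IsSkewDir Y)
    (hYP : IsPeriodicDir Y ((tower L N (j + 1) : ℕ) : ℤ)) (hYQ : QbarIter L (j + 1) W Y = 0) :
    ∃ lam : Site d → Matrix n n ℂ, lam ∈ avgKernelGauges (d := d) (n := n) L N (j + 1) W ∧
      (fun y κ => Y y κ + gaugeDir W lam y κ) ∈ frameFreeBlockLandauW (d := d) (n := n) L N (j + 1) W := by
  -- Step 1: the corner lift makes `Y` contour-tangent
  obtain ⟨hνs, hνP, hνc⟩ := testLift_skew_periodic_corner (N := N) hL j hWu hWP hx hs hWx hY hYP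
  set ν : Site d → Matrix n n ℂ := cornerLift (L ^ (j + 1)) (fun z => -framePotW L (j + 1) W Y z) with hνdef
  set Y₁ : Site d → Fin d → Matrix n n ℂ := fun y κ => Y y κ + gaugeDir W ν y κ with hY₁def
  have hT₁ : TangentIter L j W Y₁ :=
    (tangentIter_iff_dirIter_eq_zero L j W Y₁).mpr (dirIter_testLift_eq_zero (N := N) hL j hWu hWP hx hs hWx hY hYP hYQ hνdef hνs hνP)
  have hY₁s : IsSkewDir Y₁ := fun y κ => (skewAdjoint (Matrix n n ℂ)).add_mem (hY y κ) (gaugeDir_skew hWu hνs y κ)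
  have hY₁P : IsPeriodicDir Y₁ ((tower L N (j + 1) : ℕ) : ℤ) := fun y i κ => by
    simp only [hY₁def, hYP y i κ, isPeriodicDir_gaugeDir hWP hνP y i κ]
  -- Step 2: row NE3's (E_W) on the contour-tangent field
  obtain ⟨μ, hμs, hμP, hμ0, hX⟩ := exists_cornerGauge_mem_frameFreeBlockLandauW hL hLd j hWu hWP hx hs hWx hY₁s hY₁P hT₁
  -- Step 3: the total gauge parameter has vanishing nested block mean
  have hframeY₁ : ∀ z : Site d, framePotW L (j + 1) W Y₁ z = -bmeanIterW L (j + 1) W ν z := by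
    intro z
    rw [hY₁def, framePotW_add hL j hWu hx hs hWx Y (gaugeDir W ν) z, framePotW_gaugeDir hL j hWu hWP hx hs hWx hνs hνP z, hνc z]
    abel
  have hbμ : ∀ z : Site d, bmeanIterW L (j + 1) W μ z = -bmeanIterW L (j + 1) W ν z := by
    intro z
    have h0 := hX.2.2.2.1 z
    rw [framePotW_add hL j hWu hx hs hWx Y₁ (gaugeDir W μ) z, framePotW_gaugeDir hL j hWu hWP hx hs hWx hμs hμP z, hμ0 z, hframeY₁ z] at h0
    -- `h0 : -bmean ν z + (0 - bmean μ z) = 0`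
    have h1 : bmeanIterW L (j + 1) W μ z + bmeanIterW L (j + 1) W ν z = 0 := by
      rw [← neg_eq_zero, ← h0]; abel
    exact eq_neg_of_add_eq_zero_left h1
  have hsum : bmeanIterW L (j + 1) W (ν + μ) = 0 := by
    rw [bmeanIterW_add]
    funext z
    rw [Pi.add_apply, hbμ z, Pi.zero_apply, add_neg_cancel]
  -- the period in `avgKernelGauges`' spelling
  have htow : ((N * L ^ (j + 1) : ℕ) : ℤ) = ((tower L N (j + 1) : ℕ) : ℤ) := by rw [tower_eq_pow_mul, Nat.mul_comm]
  refine ⟨ν + μ, mem_avgKernelGauges_iff.mpr ⟨fun y => (skewAdjoint _).add_mem (hνs y) (hμs y), fun y i => ?_, hsum⟩, ?_⟩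
  · rw [htow, Pi.add_apply, Pi.add_apply, hνP y i, hμP y i]
  · have hfun : (fun y κ => Y y κ + gaugeDir W (ν + μ) y κ) = fun y κ => Y₁ y κ + gaugeDir W μ y κ := by
      funext y κ
      have : gaugeDir W (ν + μ) y κ = gaugeDir W ν y κ + gaugeDir W μ y κ := gaugeDir_add_fun W ν μ y κ
      simp only [hY₁def, this]
      abel
    rw [hfun]; exact hX

end Class

end

end Summit.QuantumFields.BalabanUV.T4Continuum.NE7QbarKernelDecomposition
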